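import Summits.QuantumFields.YangMills.Theses.UnitScaleTilt
import Summits.QuantumFields.YangMills.Theorems.UnitScaleTiltFluctuationComparisonRegPrOneTower
import Mathlib.Analysis.Calculus.ContDiff.Basic
import Mathlib.Analysis.InnerProductSpace.PiL2
import Mathlib.MeasureTheory.Integral.IntervalIntegral.Basic
import Mathlib.MeasureTheory.Measure.Tilted
import Mathlib.InformationTheory.KullbackLeibler.Basic
import Mathlib.Probability.Moments.Variance
import Mathlib.Probability.ConditionalProbability

/-!
# Crux idea seat `ym-cruxidea-19201-1` (ideator 1 of 2, lens: transfer) — SKETCH of the first Lean-typed steps of three idea cards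
# for stub `stub_logComparisonRegPr` of crux `FluctuationComparisonRegPr` (stmt-QuantumFields-19201, route `UnitScaleTilt`)

NOT a landing file (sorried bodies live ONLY here; cell rule).  Every statement is over tree declarations; the cards are
`run/shared/lean/pub/ym3-torus/ym-cruxidea-19201-1/cards/*.md`.

* §A (card `cutoff-duhamel-defect-insertion`): the log-linear interpolation `h_t = 1_S·ρ₀·e^{−tD}` between run `K`'s initial
  density `1_S·e^{−β_K A}` (`t = 0`) and run `K+1`'s one-step renormalised weight `1_S·w_K` (`t = 1`, `D = −β_K A − log w_K`, the
  ONE-STEP DEFECT of Wilson's action) on run `K`'s tower (one-tower normal form, landed p447414 `heightDensity_succ_ae_eq`), and the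
  SOCKET `logSandwich_of_response`: per-`t` a.e. RESPONSE bounds «the conditional expectation of `D` given the block field `V` is
  `κ_t ± r`» ⇒ the two-run log sandwich `e^{−∫κ−r} ρ^{(K)} ≤ ρ^{(K+1)} ≤ e^{−∫κ+r} ρ^{(K)}` a.e. on the small set (Duhamel/Grönwall in the
  cut-off; no disintegration, no version choice: hypotheses and conclusion are a.e. statements about fixed measurable functions).
* §B (card `discrepancy-cocycle-d4-localisation`): the `a = 0` propagation bound (maximum principle) for the two-run discrepancy down
  run `K`'s tower — exact, hypothesis-free — and the linearised-RG budget (two directions: the `tr F²` direction born at relative size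
  `g_K² = γL^{−K}` and conserved, the irrelevant rest contracting by `L^{−2}` per step) ⇒ summable for `m ≥ 4`.
* §C (card `logconcave-tower-brascamp-lieb`): the flat model of the engine — Poincaré/Brascamp–Lieb variance bound for a uniformly
  log-concave density on `ℝ^N` (Bakry–Émery), the inequality the card transports to Bałaban's constrained one-step fibre laws.

* §D (card `entropy-dpi-unit-tv`, g3 — the «honest WEAKER typed statement» branch of R134 (d)): K1 in TOTAL-VARIATION currency.  The
  deciding chain's Cauchy device consumes only `|∫W dunitLaw(K+1) − ∫W dunitLaw K| ≤ c_K` for measurable `|W| ≤ 1`, not the a.e.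
  two-sided log-density control `IsTilt`; §D types the TV socket at the unit lattice (`UnitTVAt`, `UnitTV`) and at the comparison height
  (`FluctuationComparisonTVAt`), PROVES `closes_TV : UnitTV → HistoryTail → YM3TorusSU2`, PROVES the TV socket is implied by the route's
  K1 ∧ K2 bodies (`unitTVAt_of_unitTiltAt`) and the free data-processing push-forward from height `⌊K/m⌋`
  (`unitTVAt_of_fluctuationComparisonTVAt`), and states (sorried) the relative-entropy mechanism: general Pinsker and
  `KL ≤ symmetrised KL = ∫₀¹ Var_t dt` along card 2's log-linear path (first order cancels ⇒ TV ~ √N_c·δ_K instead of N_c·δ_K).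
  §D′ (g3 session 4) adds the line's PROVING TARGETS: the conditional comparison-height laws `cmpLaw₀/₁`, the KL socket
  `FluctuationComparisonKLAt`, the typed HARDEST STUB `DiscrepancyVarianceAt` (variance of the two-run log-likelihood ratio along
  their log-geodesic `μ_s`, uniformly in `s ∈ [0,1]`, `≤ C·L^{(3/m−2)K}`), the bookkeeping lemma conditional-TV ⇒ restricted-TV
  (PROVED), `fluctuationComparisonTVAt_of_klAt` (PROVED from M1) and `closes_KL` / `closes_Var` (kernel-checked modulo M1 / M1+M2′).

References: [King1986] §3.2 p.656, §3.4 p.659; [Balaban1985UV3] (2) p.256, (41)/(47) p.266–267 and the irrelevance sentence p.267;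
[Balaban1987RG1] p.258 (Ward ⇒ `A^η(U_k)` the only marginal variable), §5 p.298; Kopper–Pedra, J. Phys. A 34 (2001) (arXiv:cond-mat/0007476) §2 (B);
Brascamp–Lieb, JFA 22 (1976); Helffer–Sjöstrand, J. Stat. Phys. 74 (1994); Bauerschmidt–Bodineau–Dagallier arXiv:2307.07619.
-/

noncomputable section

open MeasureTheory Filter Topology
open Literature.MathematicalPhysics.QuantumFieldTheory.Balaban1983to89
open Literature.MathematicalPhysics.QuantumFieldTheory.Balaban1983to89.T3ContinuumYM3Torus
open Literature.MathematicalPhysics.QuantumFieldTheory.Balaban1983to89.T3LevelShift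
open Literature.MathematicalPhysics.QuantumFieldTheory.Balaban1983to89.T3UnitLawDensityEML (ℰp measurableE_ℰp)
open Literature.MathematicalPhysics.QuantumFieldTheory.Balaban1983to89.T3UnitScaleTilt
open Literature.MathematicalPhysics.QuantumFieldTheory.Balaban1983to89.T3RestrictedUnitDensity
open Literature.MathematicalPhysics.QuantumFieldTheory.Balaban1983to89.T3TiltDescent
open Literature.MathematicalPhysics.QuantumFieldTheory.Balaban1983to89.T3DescentFibreTower
open Literature.MathematicalPhysics.QuantumFieldTheory.Balaban1983to89.T3CruxEstimates
open Literature.MathematicalPhysics.QuantumFieldTheory.Balaban1983to89.T3ConstrainedMinimiser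
open Literature.MathematicalPhysics.QuantumFieldTheory.Balaban1983to89.T3RegularMinimiser
open Literature.MathematicalPhysics.QuantumFieldTheory.Balaban1983to89.T3PrintedRegularMinimiser
open Literature.MathematicalPhysics.QuantumFieldTheory.Balaban1983to89.Missing
open Literature.MathematicalPhysics.QuantumFieldTheory.Balaban1983to89.T4Continuum

namespace Summit.QuantumFields.YangMills.Cruxes.FluctuationComparisonRegPr.IdeasTransfer

variable (F : T3Family) (K : ℕ) {n : ℕ}

/-- Run `K`'s Radon–Nikodym tower from the initial density `ρ₀`, read at the comparison height `K − n` on `(F.P n)₀`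
(the expression of p447414 `LogComparisonOneTower`, abbreviated). [cite: Balaban1985UV3, (2) p.256] -/
def towerAt (hK : n ≤ K) (ρ₀ : Density (F.P K) 0 (Matrix.specialUnitaryGroup (Fin 2) ℂ))
    (V : GaugeField (F.P n) 0 (Matrix.specialUnitaryGroup (Fin 2) ℂ)) : ℝ :=
  towerDensity F K ρ₀ (K - n)
    (fieldShift (F.sitesPerDir_eq (m := F.m) (K := K) (j := K - n) (m' := F.m) (K' := n) (j' := 0) (by omega)) V)


/-! ## §0  The transfer target common to the three cards: the DIRECT log comparison (no background subtraction, no `ε₀`)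

`BgFluctuationAt F γ b₀ p₀ m 0 0` — the tree's functional-agnostic schema with ZERO background functionals — is the a.e. statement
`0 < ρ^{(K)}, 0 < ρ^{(K+1)}, |log ρ^{(K+1)} − log ρ^{(K)} − κ_K| ≤ r_K` on `θ_n`-small `V`, `Σ r < ∞`.  It is STRONGER than the registered
stub modulo the sibling crux `MinimiserStabilityRegPr` (stmt-19200, by name) and gives the parent `UnitTilt` (stmt-18915) OUTRIGHT
(`heightSandwichAt_of_bg` with the trivial zero-background stability, then `unitTiltAt_of_heightSandwichAt`).  WHY EASIER (cards): both runs are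
ONE tower of ONE run (p447414), so the comparison never matches two independently-produced expansions or two minimisers. -/

/-- **DIRECT LOG COMPARISON** (the cards' `C⁺`; quantifier prefix of the route's items WITHOUT the regularity window `ε₀`):
the existing schema `BgFluctuationAt` at the zero backgrounds. [cite: King1986, Thm 3.4 (3.9) p.656] -/
def DirectLogComparison : Prop :=
  ∀ (L : ℕ), ∃ m₀ : ℕ, ∀ (m : ℕ), m₀ ≤ m → ∀ (b₀ p₀ : ℝ), 0 < b₀ → 2 < p₀ → ∃ γ₁ : ℝ, 0 < γ₁ ∧
    ∀ (F : T3Family) (γ : ℝ), F.L = L → 0 < γ → γ ≤ γ₁ →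
      BgFluctuationAt F γ b₀ p₀ m (fun _ _ => 0) (fun _ _ => 0)

/-- Zero backgrounds are trivially stable. [folklore] -/
theorem bgStabilityAt_zero (F' : T3Family) (γ b₀ p₀ : ℝ) (m : ℕ) :
    BgStabilityAt F' γ b₀ p₀ m (fun _ _ => 0) (fun _ _ => 0) :=
  ⟨fun _ => 0, fun _ => 0, summable_zero, fun _ => le_rfl, fun K V _ => by simp⟩

/-- **CHANGE OF BACKGROUND** (glue, proved): a direct log comparison plus the stability of ANY background pair is the fluctuation
comparison relative to that pair (triangle inequality; `κ = κ₁ + κ₂`, `r = r₁ + r₂`). [cite: King1986, (3.11)-(3.13) p.657] -/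
theorem bgFluctuationAt_of_zero_bg {F' : T3Family} {γ b₀ p₀ : ℝ} {m : ℕ}
    (A₀ A₁ : (K : ℕ) → GaugeField (F'.P (K / m)) 0 (Matrix.specialUnitaryGroup (Fin 2) ℂ) → ℝ)
    (h0 : BgFluctuationAt F' γ b₀ p₀ m (fun _ _ => 0) (fun _ _ => 0)) (hst : BgStabilityAt F' γ b₀ p₀ m A₀ A₁) :
    BgFluctuationAt F' γ b₀ p₀ m A₀ A₁ := by
  obtain ⟨r, κ, hr, hr0, hf⟩ := h0
  obtain ⟨r', κ', hr', hr0', hs⟩ := hst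
  refine ⟨fun K => r K + r' K, fun K => κ K + κ' K, hr.add hr', fun K => add_nonneg (hr0 K) (hr0' K), fun K => ?_⟩
  filter_upwards [hf K] with V hV hsm
  obtain ⟨h1, h2, h3⟩ := hV hsm
  refine ⟨h1, h2, ?_⟩
  have h4 := hs K V hsm
  rw [add_zero, add_zero] at h3
  have h5 := abs_add_le
    (Real.log (heightDensity F' γ ((Nat.div_le_self K m).trans (Nat.le_succ K))
        (histGood F' ℰp (θBal F'.L γ b₀ p₀) (K + 1) (K / m)) V) -
      Real.log (heightDensity F' γ (Nat.div_le_self K m) (histGood F' ℰp (θBal F'.L γ b₀ p₀) K (K / m)) V) - κ K)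
    (A₁ K V - A₀ K V - κ' K)
  have e : Real.log (heightDensity F' γ ((Nat.div_le_self K m).trans (Nat.le_succ K))
        (histGood F' ℰp (θBal F'.L γ b₀ p₀) (K + 1) (K / m)) V) -
      Real.log (heightDensity F' γ (Nat.div_le_self K m) (histGood F' ℰp (θBal F'.L γ b₀ p₀) K (K / m)) V) - κ K +
      (A₁ K V - A₀ K V - κ' K) =
      (Real.log (heightDensity F' γ ((Nat.div_le_self K m).trans (Nat.le_succ K))
          (histGood F' ℰp (θBal F'.L γ b₀ p₀) (K + 1) (K / m)) V) + A₁ K V) -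
        (Real.log (heightDensity F' γ (Nat.div_le_self K m) (histGood F' ℰp (θBal F'.L γ b₀ p₀) K (K / m)) V) + A₀ K V) -
        (κ K + κ' K) := by ring
  rw [e] at h5
  linarith

/-- **`DirectLogComparison ∧ MinimiserStabilityRegPr ⇒ FluctuationComparisonRegPr`** (the cards' transfer back to the crux AS TYPED: the
sibling crux stmt-19200 by name supplies the background term and the window `ε₁`; `m₀ = max`, `γ₁ = min`). [cite: King1986, Thm 3.4 p.656] -/
theorem fluctuationComparisonRegPr_of_direct (hD : DirectLogComparison)
    (hS : Summit.QuantumFields.YangMills.Theses.UnitScaleTilt.MinimiserStabilityRegPr) :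
    Summit.QuantumFields.YangMills.Theses.UnitScaleTilt.FluctuationComparisonRegPr := by
  intro L
  obtain ⟨ε₁, hε₁, h₁⟩ := hS L
  obtain ⟨m₁, hm₁⟩ := hD L
  refine ⟨ε₁, hε₁, fun ε₀ hε₀ hle => ?_⟩
  obtain ⟨m₂, hm₂⟩ := h₁ ε₀ hε₀ hle
  refine ⟨max m₁ m₂, fun m hm b₀ p₀ hb hp => ?_⟩
  obtain ⟨γ₁, hγ₁, hA⟩ := hm₁ m ((le_max_left _ _).trans hm) b₀ p₀ hb hp
  obtain ⟨γ₂, hγ₂, hB⟩ := hm₂ m ((le_max_right _ _).trans hm) b₀ p₀ hb hp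
  refine ⟨min γ₁ γ₂, lt_min hγ₁ hγ₂, fun F' γ hL hγ hγle => ?_⟩
  exact bgFluctuationAt_of_zero_bg _ _ (hA F' γ hL hγ (hγle.trans (min_le_left _ _)))
    (hB F' γ hL hγ (hγle.trans (min_le_right _ _)))

/-- **`DirectLogComparison ⇒ UnitTilt` OUTRIGHT** (the parent stmt-18915, bypassing the gen-3 split; `heightSandwichAt_of_bg` with zero
backgrounds, `unitTiltAt_of_heightSandwichAt`; `m := max m₀ 1`).  Flag for the route owner: a line built on these cards is naturally a
Line on `UnitTilt`. [cite: King1986, Thm 3.4 (3.9) p.656] -/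
theorem unitTilt_of_direct (hD : DirectLogComparison) : Summit.QuantumFields.YangMills.Theses.UnitScaleTilt.UnitTilt := by
  intro L
  obtain ⟨m₀, hm₀⟩ := hD L
  refine ⟨max m₀ 1, lt_of_lt_of_le Nat.one_pos (le_max_right _ _), fun b₀ p₀ hb hp => ?_⟩
  obtain ⟨γ₁, hγ₁, hA⟩ := hm₀ _ (le_max_left _ _) b₀ p₀ hb hp
  refine ⟨γ₁, hγ₁, fun F' γ hL hγ hγle => ?_⟩
  exact unitTiltAt_of_heightSandwichAt F' hγ.le
    (heightSandwichAt_of_bg hγ.le (bgStabilityAt_zero F' γ b₀ p₀ _) (hA F' γ hL hγ hγle))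

/-! ## §A  Cut-off Duhamel: interpolated initial densities and the response ⇒ log-sandwich socket -/

/-- **LOG-LINEAR INTERPOLATION OF THE TWO RUNS' INITIAL DENSITIES** on the event `S`: `h_t(U) = 1_S(U)·ρ₀(U)·e^{−t·D(U)}`;
for `ρ₀ = e^{−β_K A}`, `S = histGood K n` and `D = −β_K A − log w_K` (`w_K > 0` on `S`): `h_0 = 1_S e^{−β_K A}` (run `K`),
`h_1 = 1_S w_K` (run `K+1` in one-tower form); `D` is the ONE-STEP DEFECT of Wilson's action under one (0.4) averaging.
[cite: King1986, §3.2 p.656] -/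
def interp (S : Set (GaugeField (F.P K) 0 (Matrix.specialUnitaryGroup (Fin 2) ℂ)))
    (ρ₀ D : GaugeField (F.P K) 0 (Matrix.specialUnitaryGroup (Fin 2) ℂ) → ℝ) (t : ℝ) :
    Density (F.P K) 0 (Matrix.specialUnitaryGroup (Fin 2) ℂ) :=
  S.indicator fun U => ρ₀ U * Real.exp (-(t * D U))

/-- **SOCKET (card 2, first lemma; size M, hypothesis-free measure theory)**: if for every `t ∈ [0,1]` the tower of the
`D`-weighted interpolated density is, a.e. on the measurable set `E` of the comparison lattice, within `r` (relative) of `κ_t` times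
the tower of the interpolated density — «the conditional expectation of the one-step defect `D` given the block field `V` is
`κ_t ± r`, uniformly in `V ∈ E`» — then the towers at `t = 1` and `t = 0` satisfy the two-run log sandwich with constant
`e^{−∫₀¹ κ}` and radius `r` a.e. on `E`.  Proof route: test against bounded `g ≥ 0` supported in `E`
(`LogComparisonOneTower.integral_towerHeight_mul`), differentiate `t ↦ ∫_S h_t(U) g(D_{n,K}U) dU` under the integral (`D` bounded
on `S`), Grönwall, then compare densities through all tests. [cite: King1986, Thm 3.4 (3.9) p.656] -/
theorem logSandwich_of_response (hK : n ≤ K)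
    {S : Set (GaugeField (F.P K) 0 (Matrix.specialUnitaryGroup (Fin 2) ℂ))} (hS : MeasurableSet S)
    {ρ₀ D : GaugeField (F.P K) 0 (Matrix.specialUnitaryGroup (Fin 2) ℂ) → ℝ} (hρm : Measurable ρ₀) (hDm : Measurable D)
    (hρ0 : ∀ U, 0 ≤ ρ₀ U) (hρi : Integrable ρ₀ (fieldMeasure (F.P K) 0 (Matrix.specialUnitaryGroup (Fin 2) ℂ)))
    {M : ℝ} (hDM : ∀ U ∈ S, |D U| ≤ M)
    {E : Set (GaugeField (F.P n) 0 (Matrix.specialUnitaryGroup (Fin 2) ℂ))} (hE : MeasurableSet E)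
    {κ : ℝ → ℝ} (hκ : IntervalIntegrable κ volume 0 1) {r : ℝ} (hr : 0 ≤ r)
    (hresp : ∀ t ∈ Set.Icc (0 : ℝ) 1,
      ∀ᵐ V ∂fieldMeasure (F.P n) 0 (Matrix.specialUnitaryGroup (Fin 2) ℂ), V ∈ E →
        |towerAt F K hK (fun U => D U * interp F K S ρ₀ D t U) V - κ t * towerAt F K hK (interp F K S ρ₀ D t) V|
          ≤ r * towerAt F K hK (interp F K S ρ₀ D t) V) :
    ∀ᵐ V ∂fieldMeasure (F.P n) 0 (Matrix.specialUnitaryGroup (Fin 2) ℂ), V ∈ E →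
      Real.exp (-(∫ t in (0 : ℝ)..1, κ t) - r) * towerAt F K hK (interp F K S ρ₀ D 0) V
          ≤ towerAt F K hK (interp F K S ρ₀ D 1) V ∧
        towerAt F K hK (interp F K S ρ₀ D 1) V
          ≤ Real.exp (-(∫ t in (0 : ℝ)..1, κ t) + r) * towerAt F K hK (interp F K S ρ₀ D 0) V := by
  sorry

/-- **THE ENDPOINT `t = 1` IS RUN `K+1`** (reading of p447414 `heightDensity_succ_ae_eq` through `interp`): with `ρ₀ = e^{−β_K A}`,
`S = histGood K n`, `D = −β_K A − log w_K` and `w_K > 0` on `S` (the one-step small lift, stub 1 of birth v4, gives this), the tower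
of `h_1` at the comparison height is a.e. run `K+1`'s restricted height density, and the tower of `h_0` is run `K`'s (definitional).
[cite: King1986, §3.2 p.656] -/
theorem towerAt_interp_one_ae_eq (hK : n ≤ K) {γ : ℝ} (hγ : 0 ≤ γ) (θ : ℕ → ℝ)
    (hw : ∀ U ∈ histGood F ℰp θ K n, 0 < resDensity F γ (K + 1) {U' | PlaqSmall (θ (K + 1)) U'} 1
            (fieldShift (F.sitesPerDir_eq (m := F.m) (K := K + 1) (j := 1) (m' := F.m) (K' := K) (j' := 0) (by omega)) U)) :
    towerAt F K hK (interp F K (histGood F ℰp θ K n) (boltzmann (F.P K) ((F.scheme ℰp γ).β K))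
        (fun U => -((F.scheme ℰp γ).β K * wilsonAction4 U) -
          Real.log (resDensity F γ (K + 1) {U' | PlaqSmall (θ (K + 1)) U'} 1
            (fieldShift (F.sitesPerDir_eq (m := F.m) (K := K + 1) (j := 1) (m' := F.m) (K' := K) (j' := 0) (by omega)) U))) 1)
      =ᵐ[fieldMeasure (F.P n) 0 (Matrix.specialUnitaryGroup (Fin 2) ℂ)]
    heightDensity F γ (hK.trans (Nat.le_succ K)) (histGood F ℰp θ (K + 1) n) := by
  sorry

/-! ## §B  The discrepancy cocycle: `a = 0` propagation (maximum principle) and the linearised-RG budget -/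

/-- **MAXIMUM PRINCIPLE FOR THE TWO-RUN DISCREPANCY (card 1, exact lemma; size S/M)**: multiplying the initial density by `e^{Ψ}`
with `a ≤ Ψ ≤ b` on `S` multiplies every height density of run `K`'s tower by a factor in `[e^{a}, e^{b}]` (a.e.) — the oscillation of
the two-run log-discrepancy `Δ_j` never exceeds, at any height, the oscillation `b − a` of the one-step defect on the finest small
fields (the `a = 0`, no-gain bound that the card's one-step contraction improves by localisation).  Proof route: positivity and the
push-forward characterisation of the Radon–Nikodym tower, test functions. [cite: Balaban1985UV3, (2) p.256] -/
theorem towerDensity_exp_mul_sandwich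
    {S : Set (GaugeField (F.P K) 0 (Matrix.specialUnitaryGroup (Fin 2) ℂ))} (hS : MeasurableSet S)
    {h Ψ : GaugeField (F.P K) 0 (Matrix.specialUnitaryGroup (Fin 2) ℂ) → ℝ} (hhm : Measurable h) (hΨm : Measurable Ψ)
    (h0 : ∀ U, 0 ≤ h U) (hi : Integrable h (fieldMeasure (F.P K) 0 (Matrix.specialUnitaryGroup (Fin 2) ℂ)))
    {a b : ℝ} (hΨ : ∀ U ∈ S, a ≤ Ψ U ∧ Ψ U ≤ b) {j : ℕ} (hj : j ≤ F.m + K) :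
    ∀ᵐ W ∂fieldMeasure (F.P K) j (Matrix.specialUnitaryGroup (Fin 2) ℂ),
      Real.exp a * towerDensity F K (S.indicator h) j W ≤ towerDensity F K (S.indicator fun U => Real.exp (Ψ U) * h U) j W ∧
        towerDensity F K (S.indicator fun U => Real.exp (Ψ U) * h U) j W ≤ Real.exp b * towerDensity F K (S.indicator h) j W := by
  sorry

/-- **LINEARISED-RG BUDGET (card 1, support; pure real analysis, size S)**: the two directions of the discrepancy's background
content — the `tr F²` direction, born at the finest slice with relative coefficient `g_K² = γL^{−K}` and conserved down the tower
(absolute size at the comparison height `n = ⌊K/m⌋`: `≍ p(g_n)²·L^{3F.m}·L^{3n−K}`), and the irrelevant rest, born `O(1)` relative and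
contracting by `L^{−a}` per step for some `a > 0` (`≍ p(g_n)²·L^{3F.m}·L^{(3+a)n−aK}`; `a = 2` is the engineering dimension, Dimock's normalised
functionals give `a = ε` in the scalar model, arXiv:1108.1335 Lemma 11 (138)) — are summable in `K` for every `m ≥ m₀(a)` (any `m₀ > 1 + 3/a`; the
polylogarithm `p(g_n)² ≤ C(1+K)^q` is absorbed).  This is the `∃ m₀` of the registered stub in the linearised-RG organisation (owner's exponent
table: `m > 3` at `a = 2`). [cite: King1986, (3.12)-(3.13) p.657] -/
theorem budget_linearisedRG {L : ℝ} (hL : 1 < L) (q : ℝ) {a : ℝ} (ha : 0 < a) :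
    ∃ m₀ : ℕ, 0 < m₀ ∧ ∀ m : ℕ, m₀ ≤ m →
      Summable fun K : ℕ =>
        (1 + (K : ℝ)) ^ q *
          (L ^ ((3 : ℝ) * ((K / m : ℕ) : ℝ) - K) + L ^ ((3 + a) * ((K / m : ℕ) : ℝ) - a * K)) := by
  sorry

/-! ## §C  The flat model of the functional-inequality engine (card 3) -/

/-- **BRASCAMP–LIEB ⇒ POINCARÉ FOR A UNIFORMLY LOG-CONCAVE DENSITY ON `ℝ^N` (card 3, engine lemma 1; classical)**: if
`Hess H ≥ c·Id` then the (unnormalised) Gibbs measure `e^{−H}dx` satisfies `Var(f) ≤ c⁻¹ ∫ ‖∇f‖²` — stated with the variance of a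
finite measure `μ`, `∫ f² dμ − (∫ f dμ)²/μ(ℝ^N)`.  The card transports this (and its covariance form, Helffer–Sjöstrand) to Bałaban's
one-step constrained fibre laws on `SU(2)^{bonds}` (positive Ricci curvature; convexity modulo gauge from the positivity of the
constrained quadratic forms at weak coupling). [cite: Balaban1985UV3, (25) p.262] -/
theorem poincare_of_hessian_lower_bound {N : ℕ} (H : EuclideanSpace ℝ (Fin N) → ℝ) (hH : ContDiff ℝ 2 H)
    {c : ℝ} (hc : 0 < c) (hconv : ∀ x v : EuclideanSpace ℝ (Fin N), c * ‖v‖ ^ 2 ≤ iteratedFDeriv ℝ 2 H x ![v, v])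
    (hZ : Integrable (fun x => Real.exp (-H x)) (volume : Measure (EuclideanSpace ℝ (Fin N))))
    (f : EuclideanSpace ℝ (Fin N) → ℝ) (hf : ContDiff ℝ 1 f)
    (hf2 : Integrable (fun x => f x ^ 2 * Real.exp (-H x)) (volume : Measure (EuclideanSpace ℝ (Fin N))))
    (hdf : Integrable (fun x => ‖fderiv ℝ f x‖ ^ 2 * Real.exp (-H x)) (volume : Measure (EuclideanSpace ℝ (Fin N)))) :
    (∫ x, f x ^ 2 * Real.exp (-H x)) - (∫ x, f x * Real.exp (-H x)) ^ 2 / (∫ x, Real.exp (-H x))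
      ≤ c⁻¹ * ∫ x, ‖fderiv ℝ f x‖ ^ 2 * Real.exp (-H x) := by
  sorry


/-! ## §D  Card 4 (`entropy-dpi-unit-tv`): K1 in total-variation currency — the honest WEAKER typed statement and its deciding chain

Everything in §D except the three lemmas marked «mechanism, sorried» is PROVED (pure measure theory + copies of the tree's §3 chain of
`T3UnitScaleTilt` with `TVClose` for `IsTilt`).  Orientation: `TVClose μ ν t` bounds `∫ W dν − ∫ W dμ`, run `K+1` minus run `K`.
-/

section CardFour

open Literature.MathematicalPhysics.QuantumFieldTheory.Balaban1983to89.T3ThresholdRemoval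

/-- **TV-CLOSENESS** of two measures tested on measurable real observables bounded by one (twice the total-variation distance when both
are probability measures). [folklore] -/
def TVClose {X : Type*} [MeasurableSpace X] (μ ν : Measure X) (t : ℝ) : Prop :=
  ∀ W : X → ℝ, Measurable W → (∀ x, |W x| ≤ 1) → |(∫ x, W x ∂ν) - ∫ x, W x ∂μ| ≤ t

/-- Monotonicity in the radius. [folklore] -/
theorem TVClose.mono {X : Type*} [MeasurableSpace X] {μ ν : Measure X} {t t' : ℝ} (h : TVClose μ ν t) (htt' : t ≤ t') :
    TVClose μ ν t' := fun W hWm hW1 => (h W hWm hW1).trans htt'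

/-- **DATA PROCESSING (the free push-forward)**: TV-closeness is preserved by every measurable map — the TV analogue of the tree's
`IsTilt.map_measure`; this is why the `⌊K/m⌋` free top steps cost nothing in this currency either. [folklore] -/
theorem TVClose.map {X Y : Type*} [MeasurableSpace X] [MeasurableSpace Y] {μ ν : Measure X} {t : ℝ} (h : TVClose μ ν t)
    {f : X → Y} (hf : Measurable f) : TVClose (Measure.map f μ) (Measure.map f ν) t := by
  intro W hWm hW1
  rw [integral_map hf.aemeasurable hWm.aestronglyMeasurable, integral_map hf.aemeasurable hWm.aestronglyMeasurable]
  exact h (fun x => W (f x)) (hWm.comp hf) (fun x => hW1 (f x))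

/-- Bounded measurable observables are integrable against finite measures (local helper). [folklore] -/
theorem integrable_of_abs_le_one {X : Type*} [MeasurableSpace X] {W : X → ℝ} (hWm : Measurable W) (hW1 : ∀ x, |W x| ≤ 1)
    (κ : Measure X) [IsFiniteMeasure κ] : Integrable W κ :=
  Integrable.of_bound hWm.aestronglyMeasurable 1 (ae_of_all _ fun x => by rw [Real.norm_eq_abs]; exact hW1 x)

/-- `|∫ W dκ| ≤ κ(univ)` for `|W| ≤ 1` (local helper). [folklore] -/
theorem abs_integral_le_real_univ {X : Type*} [MeasurableSpace X] {W : X → ℝ} (hW1 : ∀ x, |W x| ≤ 1) (κ : Measure X)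
    [IsFiniteMeasure κ] : |∫ x, W x ∂κ| ≤ κ.real Set.univ := by
  have h1 := norm_integral_le_of_norm_le_const (μ := κ) (C := 1) (f := W)
    (ae_of_all _ fun x => by rw [Real.norm_eq_abs]; exact hW1 x)
  rwa [Real.norm_eq_abs, one_mul] at h1

/-- **THE FOUR-MEASURE LEMMA IN TV CURRENCY** (replaces `IsTilt.abs_integral_sub_le`, whose output `8r + 4w + 2w'` is all the Cauchy
device uses): good parts `t`-close, bad masses `≤ w, w'` ⇒ the full laws are `(t + w + w')`-close. [cite: King1986, Thm 3.4 (3.9)-(3.10) p.656] -/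
theorem abs_integral_sub_le_of_TVClose {X : Type*} [MeasurableSpace X] {μg μb νg νb : Measure X} [IsFiniteMeasure μg]
    [IsFiniteMeasure μb] [IsFiniteMeasure νg] [IsFiniteMeasure νb] {t w w' : ℝ} (ht : TVClose μg νg t)
    (hw : μb.real Set.univ ≤ w) (hw' : νb.real Set.univ ≤ w') {W : X → ℝ} (hWm : Measurable W) (hW1 : ∀ x, |W x| ≤ 1) :
    |(∫ x, W x ∂(νg + νb)) - ∫ x, W x ∂(μg + μb)| ≤ t + w + w' := by
  rw [integral_add_measure (integrable_of_abs_le_one hWm hW1 _) (integrable_of_abs_le_one hWm hW1 _),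
    integral_add_measure (integrable_of_abs_le_one hWm hW1 _) (integrable_of_abs_le_one hWm hW1 _)]
  obtain ⟨a1, a2⟩ := abs_le.mp (ht W hWm hW1)
  obtain ⟨b1, b2⟩ := abs_le.mp ((abs_integral_le_real_univ hW1 νb).trans hw')
  obtain ⟨c1, c2⟩ := abs_le.mp ((abs_integral_le_real_univ hW1 μb).trans hw)
  exact abs_le.mpr ⟨by linarith, by linarith⟩

/-- **K1 BODY IN TV CURRENCY** (card 4's `W` for one family, coupling, profile and free fraction `1/m`): summable `t_K` with the
unit-lattice push-forwards of run `K`'s and run `K+1`'s Gibbs measures restricted to Bałaban's UV-small-history events `t_K`-close in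
the sense of `TVClose`.  Compare `UnitTiltAt` (same measures, `IsTilt` = a.e. two-sided log-density bound). [cite: King1986, Thm 3.4 (3.9)-(3.10) p.656] -/
def UnitTVAt (F : T3Family) (γ b₀ p₀ : ℝ) (m : ℕ) : Prop :=
  ∃ t : ℕ → ℝ, Summable t ∧ ∀ K : ℕ, TVClose
    (Measure.map (unitA F ℰp K) ((gibbsK F ℰp γ K).restrict (histGood F ℰp (θBal F.L γ b₀ p₀) K (K / m))))
    (Measure.map (unitA F ℰp (K + 1))
      ((gibbsK F ℰp γ (K + 1)).restrict (histGood F ℰp (θBal F.L γ b₀ p₀) (K + 1) (K / m))))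
    (t K)

/-- **THE COMPARISON-HEIGHT FORM** (card 4's `W` where it would be proved): the two runs' restricted Gibbs measures DESCENDED to the
finest lattice of the `⌊K/m⌋`-th approximation (tree `descendTo`; these are the measures whose densities w.r.t. product Haar are the
crux's `heightDensity`, tree `map_descendTo_restrict_eq_withDensity`) are `t_K`-close, `Σ t_K < ∞`.  No densities, no backgrounds
`bgRegPr`, no constants `κ_K`, no a.e. positivity. [cite: Balaban1985UV3, (2) p.256 and (41) p.266] -/
def FluctuationComparisonTVAt (F : T3Family) (γ b₀ p₀ : ℝ) (m : ℕ) : Prop :=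
  ∃ t : ℕ → ℝ, Summable t ∧ ∀ K : ℕ, TVClose
    (Measure.map (descendTo F ℰp (K / m) K (Nat.div_le_self K m))
      ((gibbsK F ℰp γ K).restrict (histGood F ℰp (θBal F.L γ b₀ p₀) K (K / m))))
    (Measure.map (descendTo F ℰp (K / m) (K + 1) ((Nat.div_le_self K m).trans (Nat.le_succ K)))
      ((gibbsK F ℰp γ (K + 1)).restrict (histGood F ℰp (θBal F.L γ b₀ p₀) (K + 1) (K / m))))
    (t K)

/-- **FREE TOP STEPS (data processing)**: the comparison-height form implies the unit-lattice form with the same radii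
(`A_K = A_{⌊K/m⌋} ∘ D_{⌊K/m⌋,K}`, tree `unitA_comp_descendTo`). PROVED. [cite: Balaban1987RG1, (0.11) p.253] -/
theorem unitTVAt_of_fluctuationComparisonTVAt (F : T3Family) (γ b₀ p₀ : ℝ) (m : ℕ)
    (h : FluctuationComparisonTVAt F γ b₀ p₀ m) : UnitTVAt F γ b₀ p₀ m := by
  obtain ⟨t, hts, h⟩ := h
  refine ⟨t, hts, fun K => ?_⟩
  rw [← unitA_comp_descendTo F ℰp (Nat.div_le_self K m),
    ← unitA_comp_descendTo F ℰp ((Nat.div_le_self K m).trans (Nat.le_succ K)),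
    ← Measure.map_map (measurable_unitA F ℰp measurableE_ℰp (K / m)) (measurable_descendTo F ℰp measurableE_ℰp _),
    ← Measure.map_map (measurable_unitA F ℰp measurableE_ℰp (K / m)) (measurable_descendTo F ℰp measurableE_ℰp _)]
  exact (h K).map (measurable_unitA F ℰp measurableE_ℰp (K / m))

/-- **TV SOCKET + TAILS ⇒ SUMMABLE-SHAPED INCREMENTS OF THE FULL UNIT LAWS** (`γ ≥ 0`, any thresholds `θ`, any number `n` of free
steps): `|∫ W dunitLaw(K+1) − ∫ W dunitLaw K| ≤ t + w + w'`. PROVED. [cite: King1986, Thm 3.4 (3.9)-(3.10) p.656] -/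
theorem abs_integral_unitLaw_succ_sub_le_of_TV (F : T3Family) {γ : ℝ} (hγ : 0 ≤ γ) (θ : ℕ → ℝ) (n K : ℕ) {t w w' : ℝ}
    (ht : TVClose (Measure.map (unitA F ℰp K) ((gibbsK F ℰp γ K).restrict (histGood F ℰp θ K n)))
      (Measure.map (unitA F ℰp (K + 1)) ((gibbsK F ℰp γ (K + 1)).restrict (histGood F ℰp θ (K + 1) n))) t)
    (hw : (gibbsK F ℰp γ K).real (histGood F ℰp θ K n)ᶜ ≤ w)
    (hw' : (gibbsK F ℰp γ (K + 1)).real (histGood F ℰp θ (K + 1) n)ᶜ ≤ w')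
    {W : GaugeField (F.P 0) 0 (Matrix.specialUnitaryGroup (Fin 2) ℂ) → ℝ} (hWm : Measurable W) (hW1 : ∀ u, |W u| ≤ 1) :
    |(∫ u, W u ∂F.unitLaw ℰp measurableE_ℰp γ (K + 1)) - ∫ u, W u ∂F.unitLaw ℰp measurableE_ℰp γ K| ≤ t + w + w' := by
  haveI := isProbabilityMeasure_gibbsK F ℰp hγ K
  haveI := isProbabilityMeasure_gibbsK F ℰp hγ (K + 1)
  rw [unitLaw_eq_map_restrict_add measurableE_ℰp (K + 1) (measurableSet_histGood F ℰp measurableE_ℰp θ (K + 1) n),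
    unitLaw_eq_map_restrict_add measurableE_ℰp K (measurableSet_histGood F ℰp measurableE_ℰp θ K n)]
  refine abs_integral_sub_le_of_TVClose ht ?_ ?_ hWm hW1
  · rw [real_map_restrict_univ measurableE_ℰp]; exact hw
  · rw [real_map_restrict_univ measurableE_ℰp]; exact hw'

/-- **THE TV SOCKET IS WEAKER THAN THE ROUTE'S K1 BODY GIVEN ITS K2 BODY** (`γ ≥ 0`): `UnitTiltAt ∧ HistoryTailAt ⇒ UnitTVAt` with
`t_K = 8r_K + 8w_K` (tree four-measure lemma for the full laws, then peel the bad parts off again). PROVED. [cite: King1986, Thm 3.4 (3.9)-(3.10) p.656] -/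
theorem unitTVAt_of_unitTiltAt (F : T3Family) {γ : ℝ} (hγ : 0 ≤ γ) {b₀ p₀ : ℝ} {m : ℕ} (h1 : UnitTiltAt F γ b₀ p₀ m)
    (h2 : HistoryTailAt F γ b₀ p₀ m) : UnitTVAt F γ b₀ p₀ m := by
  obtain ⟨r, hr, ht⟩ := h1
  obtain ⟨w, hw, hb⟩ := h2
  have hTT : UnitTiltTail F ℰp γ r w w :=
    ⟨fun K => histGood F ℰp (θBal F.L γ b₀ p₀) K (K / m), fun K => histGood F ℰp (θBal F.L γ b₀ p₀) (K + 1) (K / m),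
      fun K => measurableSet_histGood F ℰp measurableE_ℰp _ K _,
      fun K => measurableSet_histGood F ℰp measurableE_ℰp _ (K + 1) _, ht, hb⟩
  refine ⟨fun K => 8 * r K + 8 * w K, (hr.mul_left 8).add (hw.mul_left 8), fun K W hWm hW1 => ?_⟩
  have hfull := abs_integral_unitLaw_succ_sub_le measurableE_ℰp hγ hTT hWm hW1 K
  haveI := isProbabilityMeasure_gibbsK F ℰp hγ K
  haveI := isProbabilityMeasure_gibbsK F ℰp hγ (K + 1)
  have hmS₀ : MeasurableSet (histGood F ℰp (θBal F.L γ b₀ p₀) K (K / m)) := measurableSet_histGood F ℰp measurableE_ℰp _ K _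
  have hmS₁ : MeasurableSet (histGood F ℰp (θBal F.L γ b₀ p₀) (K + 1) (K / m)) :=
    measurableSet_histGood F ℰp measurableE_ℰp _ (K + 1) _
  rw [unitLaw_eq_map_restrict_add measurableE_ℰp (K + 1) hmS₁, unitLaw_eq_map_restrict_add measurableE_ℰp K hmS₀,
    integral_add_measure (integrable_of_abs_le_one hWm hW1 _) (integrable_of_abs_le_one hWm hW1 _),
    integral_add_measure (integrable_of_abs_le_one hWm hW1 _) (integrable_of_abs_le_one hWm hW1 _)] at hfull
  have hb1 : |∫ u, W u ∂Measure.map (unitA F ℰp (K + 1))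
      ((gibbsK F ℰp γ (K + 1)).restrict (histGood F ℰp (θBal F.L γ b₀ p₀) (K + 1) (K / m))ᶜ)| ≤ w K := by
    refine (abs_integral_le_real_univ hW1 _).trans ?_
    rw [real_map_restrict_univ measurableE_ℰp]; exact (hb K).2
  have hb0 : |∫ u, W u ∂Measure.map (unitA F ℰp K)
      ((gibbsK F ℰp γ K).restrict (histGood F ℰp (θBal F.L γ b₀ p₀) K (K / m))ᶜ)| ≤ w K := by
    refine (abs_integral_le_real_univ hW1 _).trans ?_
    rw [real_map_restrict_univ measurableE_ℰp]; exact (hb K).1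
  obtain ⟨f1, f2⟩ := abs_le.mp hfull
  obtain ⟨a1, a2⟩ := abs_le.mp hb1
  obtain ⟨c1, c2⟩ := abs_le.mp hb0
  exact abs_le.mpr ⟨by linarith, by linarith⟩

/-- Products of a list of measurable real functions are measurable (copy of the tree's private helper). [folklore] -/
theorem measurable_list_prod' {Y : Type*} [MeasurableSpace Y] {ι : Type*} (f : ι → Y → ℝ)
    (hf : ∀ i, Measurable (f i)) : ∀ l : List ι, Measurable fun x => (l.map fun i => f i x).prod
  | [] => by simp
  | i :: l => by
    show Measurable fun x => f i x * (l.map fun i => f i x).prod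
    exact (hf i).mul (measurable_list_prod' f hf l)

/-- Products of a list of functions bounded by `1` are bounded by `1` (copy of the tree's private helper). [folklore] -/
theorem abs_list_prod_le_one' {Y : Type*} {ι : Type*} (f : ι → Y → ℝ) (hf : ∀ i x, |f i x| ≤ 1) (x : Y) :
    ∀ l : List ι, |(l.map fun i => f i x).prod| ≤ 1
  | [] => by simp
  | i :: l => by
    rw [List.map_cons, List.prod_cons, abs_mul]
    exact mul_le_one₀ (hf i x) (abs_nonneg _) (abs_list_prod_le_one' f hf x l)

/-- **SUMMABLE TV-SHAPED INCREMENTS ⇒ THE CONTINUUM LIMIT** of the family's joint loop expectations (`γ ≥ 0`) — the tree's Cauchy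
device `exists_tendsto_integral_unitLaw` ∘ `hasContinuumLimit_of_unitTiltTail` with the increment bound as the hypothesis. PROVED.
[cite: King1986, Thm 2.1 p.654 and (3.13) p.657] -/
theorem hasContinuumLimit_of_increments (F : T3Family) {γ : ℝ} (hγ : 0 ≤ γ) {c : ℕ → ℝ} (hc : Summable c)
    (h : ∀ (K : ℕ) (W : GaugeField (F.P 0) 0 (Matrix.specialUnitaryGroup (Fin 2) ℂ) → ℝ), Measurable W → (∀ u, |W u| ≤ 1) →
      |(∫ u, W u ∂F.unitLaw ℰp measurableE_ℰp γ (K + 1)) - ∫ u, W u ∂F.unitLaw ℰp measurableE_ℰp γ K| ≤ c K) :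
    HasContinuumLimit (F.scheme ℰp γ) := by
  intro Cs
  have hWm := measurable_list_prod'
    (fun (C : ULoop3 F) (u : GaugeField (F.P 0) 0 (Matrix.specialUnitaryGroup (Fin 2) ℂ)) => loopAt u (C.1.atLevel 0))
    (fun C => measurable_loopAt _) Cs
  have hW1 := fun u => abs_list_prod_le_one'
    (fun (C : ULoop3 F) (u : GaugeField (F.P 0) 0 (Matrix.specialUnitaryGroup (Fin 2) ℂ)) => loopAt u (C.1.atLevel 0))
    (fun C u => abs_loopAt_le_one _ _) u Cs
  have hcs : CauchySeq fun K => ∫ u, (Cs.map fun C => loopAt u (C.1.atLevel 0)).prod ∂F.unitLaw ℰp measurableE_ℰp γ K :=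
    cauchySeq_of_dist_le_of_summable _
      (fun K => by
        rw [Real.dist_eq, abs_sub_comm]
        exact h K _ hWm hW1) hc
  obtain ⟨l, hl⟩ := cauchySeq_tendsto_of_complete hcs
  refine ⟨l, ?_⟩
  have hkey : (fun K => (F.scheme ℰp γ).expectAt K Cs) =
      fun K => ∫ u, (Cs.map fun C => loopAt u (C.1.atLevel 0)).prod ∂F.unitLaw ℰp measurableE_ℰp γ K :=
    funext fun K => expectAt_eq_integral_unitLaw measurableE_ℰp hγ K Cs
  rw [hkey]
  exact hl

/-- **THE SAME UNDER REFINEMENT** (threshold removal): summable increments for the refined family `F.refine n` at `γL^{-n}` ⇒ the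
continuum limit of the ORIGINAL family (tree `expectAt_refine`, `coarseObs`). PROVED. [cite: Balaban1985UV3, (1)-(3) p.256] -/
theorem hasContinuumLimit_of_refine_increments (F : T3Family) (n : ℕ) {γ : ℝ} (hγ : 0 ≤ γ) {c : ℕ → ℝ} (hc : Summable c)
    (h : ∀ (K : ℕ) (W : GaugeField ((F.refine n).P 0) 0 (Matrix.specialUnitaryGroup (Fin 2) ℂ) → ℝ), Measurable W →
      (∀ u, |W u| ≤ 1) →
      |(∫ u, W u ∂(F.refine n).unitLaw ℰp measurableE_ℰp (γ * ((F.L : ℝ)⁻¹) ^ n) (K + 1)) -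
          ∫ u, W u ∂(F.refine n).unitLaw ℰp measurableE_ℰp (γ * ((F.L : ℝ)⁻¹) ^ n) K| ≤ c K) :
    HasContinuumLimit (F.scheme ℰp γ) := by
  intro Cs
  have hcs : CauchySeq fun K =>
      ∫ u, coarseObs F n ℰp Cs u ∂(F.refine n).unitLaw ℰp measurableE_ℰp (γ * ((F.L : ℝ)⁻¹) ^ n) K :=
    cauchySeq_of_dist_le_of_summable _
      (fun K => by
        rw [Real.dist_eq, abs_sub_comm]
        exact h K _ (measurable_coarseObs F n ℰp measurableE_ℰp Cs) (abs_coarseObs_le_one F n ℰp Cs)) hc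
  obtain ⟨l, hl⟩ := cauchySeq_tendsto_of_complete hcs
  refine ⟨l, (tendsto_add_atTop_iff_nat n).mp ?_⟩
  have hkey : (fun K => (F.scheme ℰp γ).expectAt (K + n) Cs) =
      fun K => ∫ u, coarseObs F n ℰp Cs u ∂(F.refine n).unitLaw ℰp measurableE_ℰp (γ * ((F.L : ℝ)⁻¹) ^ n) K :=
    funext fun K => expectAt_refine F n ℰp measurableE_ℰp hγ K Cs
  rw [hkey]
  exact hl

/-- **TV SOCKET ∧ K2 BODY at the refined family ⇒ `ContinuumYM3Torus F expMeanLogSU γ`** (`γ ≥ 0`; RP, covariance, uniqueness are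
tree theorems, `continuumYM3Torus_iff_hasContinuumLimit_SU`). PROVED. [cite: JaffeWittenClay2006, §6.5 p.11] -/
theorem continuumYM3Torus_of_unitTVAt_historyTailAt (F : T3Family) {γ : ℝ} (hγ : 0 ≤ γ) (n : ℕ) {b₀ p₀ : ℝ} {m : ℕ}
    (hγn : 0 ≤ γ * ((F.L : ℝ)⁻¹) ^ n)
    (h1 : UnitTVAt (F.refine n) (γ * ((F.L : ℝ)⁻¹) ^ n) b₀ p₀ m)
    (h2 : HistoryTailAt (F.refine n) (γ * ((F.L : ℝ)⁻¹) ^ n) b₀ p₀ m) : ContinuumYM3Torus F ℰp γ := by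
  obtain ⟨t, hts, ht⟩ := h1
  obtain ⟨w, hws, hw⟩ := h2
  exact (continuumYM3Torus_iff_hasContinuumLimit_SU F ℰp measurableE_ℰp hγ).mpr
    (hasContinuumLimit_of_refine_increments F n hγ ((hts.add hws).add hws) fun K W hWm hW1 =>
      abs_integral_unitLaw_succ_sub_le_of_TV (F.refine n) hγn _ (K / m) K (ht K) (hw K).1 (hw K).2 hWm hW1)

/-- Refinement depth below a threshold (copy of the tree's private helper `exists_refine_depth`). [folklore] -/
theorem exists_refine_depth' {L : ℕ} (hL : 1 < L) {γ γ₁ : ℝ} (hγ : 0 < γ) (hγ₁ : 0 < γ₁) :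
    ∃ n : ℕ, 0 < γ * ((L : ℝ)⁻¹) ^ n ∧ γ * ((L : ℝ)⁻¹) ^ n ≤ γ₁ := by
  have hL' : (1 : ℝ) < L := by exact_mod_cast hL
  have hL0 : (0 : ℝ) < L := zero_lt_one.trans hL'
  obtain ⟨n, hn⟩ := ((tendsto_pow_atTop_nhds_zero_of_lt_one (inv_nonneg.mpr hL0.le)
    (inv_lt_one_of_one_lt₀ hL')).eventually (ge_mem_nhds (div_pos hγ₁ hγ))).exists
  refine ⟨n, mul_pos hγ (pow_pos (inv_pos.mpr hL0) n), ?_⟩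
  have e := mul_le_mul_of_nonneg_left hn hγ.le
  rwa [mul_div_cancel₀ _ hγ.ne'] at e

/-- **CARD 4's `W` IN THE ROUTE'S QUANTIFIER SHAPE — K1 IN TV CURRENCY** (`UnitTilt` with `UnitTVAt` for `UnitTiltAt`).  Strictly WEAKER
than `UnitTilt ∧ (K2 at the same profiles)` by `unitTVAt_of_unitTiltAt`; decides the leaf all the same (`closes_TV`). NOT PRINTED for any
non-abelian model (abelian template [King1986] Thm 3.4 is stated in the tilt currency (3.9) but USED only through (3.10)). [cite: King1986, Thm 3.4 (3.9)-(3.13) p.656] -/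
def UnitTV : Prop :=
  ∀ (L : ℕ), ∃ m : ℕ, 0 < m ∧ ∀ (b₀ p₀ : ℝ), 0 < b₀ → 2 < p₀ → ∃ γ₁ : ℝ, 0 < γ₁ ∧
    ∀ (F : T3Family) (γ : ℝ), F.L = L → 0 < γ → γ ≤ γ₁ → UnitTVAt F γ b₀ p₀ m

/-- **THE SAME AT THE COMPARISON HEIGHT** (where card 4 proposes to prove it, by relative entropy + Pinsker). [cite: Balaban1985UV3, (41) p.266] -/
def FluctuationComparisonTV : Prop :=
  ∀ (L : ℕ), ∃ m : ℕ, 0 < m ∧ ∀ (b₀ p₀ : ℝ), 0 < b₀ → 2 < p₀ → ∃ γ₁ : ℝ, 0 < γ₁ ∧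
    ∀ (F : T3Family) (γ : ℝ), F.L = L → 0 < γ → γ ≤ γ₁ → FluctuationComparisonTVAt F γ b₀ p₀ m

/-- Comparison height ⇒ unit lattice, packaged. PROVED. [cite: Balaban1987RG1, (0.11) p.253] -/
theorem unitTV_of_fluctuationComparisonTV (h : FluctuationComparisonTV) : UnitTV := by
  intro L
  obtain ⟨m, hm, hS⟩ := h L
  refine ⟨m, hm, fun b₀ p₀ hb₀ hp₀ => ?_⟩
  obtain ⟨γ₁, hγ₁, hS⟩ := hS b₀ p₀ hb₀ hp₀
  exact ⟨γ₁, hγ₁, fun F γ hF hγ hle => unitTVAt_of_fluctuationComparisonTVAt F γ b₀ p₀ m (hS F γ hF hγ hle)⟩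

/-- **THE DECIDING THEOREM IN TV CURRENCY**: `UnitTV → HistoryTail → YM3TorusSU2` — literally the shape of the route's `closes` with the
weaker K1 (order of choices as in the tree's PACKAGE B: `m` from K1 at `L = F.L`, profile + threshold from K2 at `(L, m)`, K1's threshold
at that profile, refine below both). PROVED. [cite: King1986, (3.12)-(3.13) p.657] -/
theorem closes_TV (hK1 : UnitTV) (hK2 : Summit.QuantumFields.YangMills.Theses.UnitScaleTilt.HistoryTail) :
    T3YM3TorusStatement.YM3TorusSU2 := by
  refine ⟨1, one_pos, fun F γ hγ _ => ?_⟩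
  obtain ⟨m, hm, hS⟩ := hK1 F.L
  obtain ⟨b₀, p₀, γ₂, hb₀, hp₀, hγ₂, hT⟩ := hK2 F.L m hm
  obtain ⟨γ₃, hγ₃, hS⟩ := hS b₀ p₀ hb₀ hp₀
  obtain ⟨n, hpos, hle⟩ := exists_refine_depth' F.hL.2 hγ (lt_min hγ₂ hγ₃)
  exact continuumYM3Torus_of_unitTVAt_historyTailAt F hγ.le n hpos.le
    (hS (F.refine n) _ rfl hpos (hle.trans (min_le_right _ _)))
    (hT (F.refine n) _ rfl hpos (hle.trans (min_le_left _ _)))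

/-- … and from the comparison-height form. PROVED. [cite: King1986, (3.12)-(3.13) p.657] -/
theorem closes_TV' (hW : FluctuationComparisonTV) (hK2 : Summit.QuantumFields.YangMills.Theses.UnitScaleTilt.HistoryTail) :
    T3YM3TorusStatement.YM3TorusSU2 :=
  closes_TV (unitTV_of_fluctuationComparisonTV hW) hK2

/-! ### The relative-entropy mechanism (sorried idea lemmas M1–M3; bodies live only here) -/

/-- **M1 · PINSKER FOR GENERAL PROBABILITY MEASURES** («mechanism, sorried»): `KL(ν‖μ) ≤ H` ⇒ `|∫ W dν − ∫ W dμ| ≤ √(2H)` for measurable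
`|W| ≤ 1`.  Mathlib has `InformationTheory.klDiv` but no Pinsker; the tree's sharp Pinsker `Literature.Probability.Entropy.two_mul_tvDist_sq_le_kl`
is finite-state.  Derivation path: binary Pinsker `two_mul_sq_sub_le_binaryKL` + data processing of `klDiv` onto the partition `{W ≥ s}`,
or the variational (Donsker–Varadhan) form `Literature.Probability.Divergences.integral_le_toReal_klDiv_add_log` with `ψ = λW`, optimise `λ`.
[cite: PolyanskiyWu2024, Thm 7.10] -/
theorem tvClose_of_klDiv_le {X : Type*} [MeasurableSpace X] (μ ν : Measure X) [IsProbabilityMeasure μ] [IsProbabilityMeasure ν]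
    {H : ℝ} (hH : 0 ≤ H) (hKL : InformationTheory.klDiv ν μ ≤ ENNReal.ofReal H) : TVClose μ ν (Real.sqrt (2 * H)) := by
  sorry

/-- **M2 · ENTROPY ≤ SYMMETRISED ENTROPY = INTEGRATED VARIANCE ALONG THE LOG-LINEAR PATH** («mechanism, sorried»): for a probability
measure `μ` and a bounded measurable `D`, the exponential tilt `ν = μ.tilted (−D) = Z⁻¹e^{−D}μ` has
`KL(ν‖μ) ≤ ∫ D dμ − ∫ D dν` (`= KL(ν‖μ) + KL(μ‖ν) = ∫₀¹ Var_{μ.tilted(−sD)}(D) ds`, since `d/ds ∫ D d(μ.tilted(−sD)) = −Var`).  THE FIRST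
ORDER CANCELS: with `D = Σ_x d_x` a sum of `N` local terms of size `δ` and summable connected correlations, the right side is `O(N δ²)`,
so by M1 the TV radius is `O(√N·δ)` where the sup-norm radius of `IsTilt` is `O(N·δ)`. [cite: PolyanskiyWu2024, Thm 7.10] -/
theorem toReal_klDiv_tilted_le {X : Type*} [MeasurableSpace X] (μ : Measure X) [IsProbabilityMeasure μ] {D : X → ℝ}
    (hDm : Measurable D) {C : ℝ} (hDb : ∀ x, |D x| ≤ C) :
    (InformationTheory.klDiv (μ.tilted fun x => -D x) μ).toReal ≤ (∫ x, D x ∂μ) - ∫ x, D x ∂(μ.tilted fun x => -D x) := by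
  sorry

/-- **M3 · THE EXPONENT RACE IN TV CURRENCY** («arithmetic, sorried as routine»): with `N₃(⌊K/m⌋) ≍ L^{3⌊K/m⌋}` sites at the comparison
height and a per-site two-run discrepancy of relative size `γL^{-K}` (card 1's conserved marginal direction; the irrelevant rest is
smaller), the TV radius `√N₃·γL^{-K} ≤ γ·L^{(3/(2m) − 1)K}` is summable for every `m ≥ 2` — where the sup-norm radius `N₃·γL^{-K}`
needs `m ≥ 4` (the owner's `m₀ = 4`). [cite: King1986, (3.12) p.657] -/
theorem summable_tv_race {L : ℝ} (hL : 1 < L) {m : ℕ} (hm : 2 ≤ m) (γ : ℝ) :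
    Summable fun K : ℕ => γ * (Real.sqrt (L ^ (3 * (K / m)))) * L ^ (-(K : ℝ)) := by
  sorry

/-! ### §D′ (g3, session 4) — the line's PROVING TARGETS in entropy currency
The two runs' laws GIVEN small history seen at the comparison height (`cmpLaw₀`, `cmpLaw₁`), the KL socket
(`FluctuationComparisonKLAt`), the typed HARDEST STUB (`DiscrepancyVarianceAt`: variance of the two-run discrepancy along their
log-geodesic), the normalisation glue conditional-TV ⇒ restricted-TV (PROVED), KL ⇒ TV (PROVED from M1) and the deciding theorems
`closes_KL` (kernel-checked modulo M1 only) / `closes_Var` (modulo M1, M2′). -/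

/-- **RUN `K` GIVEN SMALL HISTORY, SEEN AT THE COMPARISON HEIGHT**: the Gibbs law of the `K`-th approximation CONDITIONED on Bałaban's
UV-small-history event (free fraction `1/m`; Mathlib `ProbabilityTheory.cond`) and descended to the finest lattice of the `⌊K/m⌋`-th
approximation (tree `descendTo`) — the first measure of `FluctuationComparisonTVAt`, normalised. [cite: Balaban1985UV3, (2) p.256 and (7) p.257] -/
def cmpLaw₀ (F : T3Family) (γ b₀ p₀ : ℝ) (m K : ℕ) :
    Measure (GaugeField (F.P (K / m)) 0 (Matrix.specialUnitaryGroup (Fin 2) ℂ)) :=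
  Measure.map (descendTo F ℰp (K / m) K (Nat.div_le_self K m))
    (ProbabilityTheory.cond (gibbsK F ℰp γ K) (histGood F ℰp (θBal F.L γ b₀ p₀) K (K / m)))

/-- **RUN `K+1` GIVEN SMALL HISTORY, SEEN AT THE SAME HEIGHT** (descended `K + 1 − ⌊K/m⌋` levels). [cite: Balaban1985UV3, (2) p.256 and (7) p.257] -/
def cmpLaw₁ (F : T3Family) (γ b₀ p₀ : ℝ) (m K : ℕ) :
    Measure (GaugeField (F.P (K / m)) 0 (Matrix.specialUnitaryGroup (Fin 2) ℂ)) :=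
  Measure.map (descendTo F ℰp (K / m) (K + 1) ((Nat.div_le_self K m).trans (Nat.le_succ K)))
    (ProbabilityTheory.cond (gibbsK F ℰp γ (K + 1)) (histGood F ℰp (θBal F.L γ b₀ p₀) (K + 1) (K / m)))

/-- **THE KL SOCKET** (card 4's proving target, one family/coupling/profile/free fraction): square-root-summable relative entropies
of run `K+1` with respect to run `K` at the comparison height.  No densities, no backgrounds, no constants `κ_K`, no a.e. two-sided
bounds. NOT PRINTED for any lattice gauge model (the perturbative «distinguishability density» of Bény, Quantum 2 (2018) 67, is its
heuristic shadow). [cite: PolyanskiyWu2024, Thm 7.10] -/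
def FluctuationComparisonKLAt (F : T3Family) (γ b₀ p₀ : ℝ) (m : ℕ) : Prop :=
  ∃ h : ℕ → ℝ, (∀ K, 0 ≤ h K) ∧ (Summable fun K => Real.sqrt (h K)) ∧
    ∀ K : ℕ, InformationTheory.klDiv (cmpLaw₁ F γ b₀ p₀ m K) (cmpLaw₀ F γ b₀ p₀ m K) ≤ ENNReal.ofReal (h K)

/-- **THE TWO-RUN DISCREPANCY at the comparison height**: the log-likelihood ratio of run `K+1` to run `K` (Mathlib `llr`; it is
card 1's cocycle value `Δ_{⌊K/m⌋}` up to the normalising constant). [cite: Balaban1985UV3, (41) p.266] -/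
def discrepancy (F : T3Family) (γ b₀ p₀ : ℝ) (m K : ℕ) :
    GaugeField (F.P (K / m)) 0 (Matrix.specialUnitaryGroup (Fin 2) ℂ) → ℝ :=
  MeasureTheory.llr (cmpLaw₁ F γ b₀ p₀ m K) (cmpLaw₀ F γ b₀ p₀ m K)

/-- **THE LOG-GEODESIC** (one-parameter exponential family) joining run `K` (`s = 0`) to run `K+1` (`s = 1`, given
`cmpLaw₁ ≪ cmpLaw₀`) at the comparison height: `μ_s ∝ (dν/dμ)^s·μ` (Mathlib `Measure.tilted`). [cite: PolyanskiyWu2024, Thm 7.10] -/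
def geodesic (F : T3Family) (γ b₀ p₀ : ℝ) (m K : ℕ) (s : ℝ) :
    Measure (GaugeField (F.P (K / m)) 0 (Matrix.specialUnitaryGroup (Fin 2) ℂ)) :=
  (cmpLaw₀ F γ b₀ p₀ m K).tilted fun V => s * discrepancy F γ b₀ p₀ m K V

/-- **V · THE HARDEST STUB OF THE LINE, TYPED — VARIANCE OF THE DISCREPANCY ALONG THE GEODESIC**: uniformly in `s ∈ [0,1]`,
`Var_{μ_s}(Δ) ≤ C·L^{(3/m − 2)K}` (`≍ L^{3K/m}` sites at the comparison height × the per-site two-run discrepancy `≍ γp²L^{-K}` SQUARED ×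
summable connected correlations), with the honest side conditions: absolute continuity (else `KL = ∞`) and `Δ ∈ L²(μ_s)` (else Mathlib's
`variance` is the junk value `0`).  LOCATED-UNPRINTED for the non-abelian `d = 3` tower (abelian template: King's graph-wise comparison;
perturbative template: Bény's distinguishability density). [cite: King1986, Thm 3.4 (3.9)-(3.10) p.656] -/
def DiscrepancyVarianceAt (F : T3Family) (γ b₀ p₀ : ℝ) (m : ℕ) : Prop :=
  ∃ C : ℝ, ∀ (K : ℕ) (s : ℝ), s ∈ Set.Icc (0 : ℝ) 1 →
    (cmpLaw₁ F γ b₀ p₀ m K ≪ cmpLaw₀ F γ b₀ p₀ m K) ∧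
    MemLp (discrepancy F γ b₀ p₀ m K) 2 (geodesic F γ b₀ p₀ m K s) ∧
    ProbabilityTheory.variance (discrepancy F γ b₀ p₀ m K) (geodesic F γ b₀ p₀ m K s)
      ≤ C * (F.L : ℝ) ^ (((3 : ℝ) / (m : ℝ) - 2) * (K : ℝ))

/-- **M2′ + M3 · VARIANCE STUB ⇒ KL SOCKET** («mechanism + arithmetic, sorried»): `KL(ν‖μ) ≤ ∫₀¹ Var_{μ_s}(Δ) ds` — the Bregman
divergence of the convex `s ↦ log ∫ (dν/dμ)^s dμ` (Mathlib `ProbabilityTheory.cgf`, `integral_tilted_mul_self`, `variance_tilted_mul`),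
first order cancelling exactly — and `√(C·L^{(3/m−2)K}) = √C·L^{(3/(2m)−1)K}` is summable iff `m ≥ 2` (M3). [cite: PolyanskiyWu2024, Thm 7.10] -/
theorem klAt_of_varianceAt (F : T3Family) {γ b₀ p₀ : ℝ} {m : ℕ} (hm : 2 ≤ m)
    (hV : DiscrepancyVarianceAt F γ b₀ p₀ m) : FluctuationComparisonKLAt F γ b₀ p₀ m := by
  sorry

/-- **CONDITIONAL TV-CLOSENESS + SMALL BAD MASSES ⇒ RESTRICTED TV-CLOSENESS** — the normalisation bookkeeping between sockets stated on
CONDITIONAL laws (KL, geodesic, variance need probability measures) and the route's RESTRICTED laws; degenerate good events (mass `0`)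
are covered by the `2w` term. PROVED. [folklore] -/
theorem tvClose_map_restrict_of_cond {X X' Y : Type*} [MeasurableSpace X] [MeasurableSpace X'] [MeasurableSpace Y]
    {μ : Measure X} {ν : Measure X'} [IsProbabilityMeasure μ] [IsProbabilityMeasure ν] {S : Set X} {T : Set X'}
    (hS : MeasurableSet S) (hT : MeasurableSet T) {f : X → Y} {g : X' → Y} (hf : Measurable f) (hg : Measurable g)
    {t w : ℝ} (ht : 0 ≤ t)
    (h : μ S ≠ 0 → ν T ≠ 0 →
      TVClose (Measure.map f (ProbabilityTheory.cond μ S)) (Measure.map g (ProbabilityTheory.cond ν T)) t)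
    (hSw : μ.real Sᶜ ≤ w) (hTw : ν.real Tᶜ ≤ w) :
    TVClose (Measure.map f (μ.restrict S)) (Measure.map g (ν.restrict T)) (t + 2 * w) := by
  intro W hWm hW1
  have hw0 : 0 ≤ w := le_trans measureReal_nonneg hSw
  have haS : μ.real S = 1 - μ.real Sᶜ := by rw [probReal_compl_eq_one_sub hS]; ring
  have hbT : ν.real T = 1 - ν.real Tᶜ := by rw [probReal_compl_eq_one_sub hT]; ring
  have hmS : (Measure.map f (μ.restrict S)).real Set.univ = μ.real S := by
    simp only [measureReal_def, Measure.map_apply hf MeasurableSet.univ, Set.preimage_univ,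
      Measure.restrict_apply MeasurableSet.univ, Set.univ_inter]
  have hmT : (Measure.map g (ν.restrict T)).real Set.univ = ν.real T := by
    simp only [measureReal_def, Measure.map_apply hg MeasurableSet.univ, Set.preimage_univ,
      Measure.restrict_apply MeasurableSet.univ, Set.univ_inter]
  have hRS : |∫ y, W y ∂Measure.map f (μ.restrict S)| ≤ μ.real S := hmS ▸ abs_integral_le_real_univ hW1 _
  have hRT : |∫ y, W y ∂Measure.map g (ν.restrict T)| ≤ ν.real T := hmT ▸ abs_integral_le_real_univ hW1 _
  have ha1 : μ.real S ≤ 1 := measureReal_le_one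
  have hb1 : ν.real T ≤ 1 := measureReal_le_one
  by_cases ha : μ S = 0
  · have h0 : Measure.map f (μ.restrict S) = 0 := by rw [Measure.restrict_eq_zero.mpr ha, Measure.map_zero]
    have hS0 : μ.real S = 0 := by simp [measureReal_def, ha]
    rw [h0, integral_zero_measure, sub_zero]
    calc |∫ y, W y ∂Measure.map g (ν.restrict T)| ≤ ν.real T := hRT
      _ ≤ t + 2 * w := by linarith
  by_cases hb : ν T = 0
  · have h0 : Measure.map g (ν.restrict T) = 0 := by rw [Measure.restrict_eq_zero.mpr hb, Measure.map_zero]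
    have hT0 : ν.real T = 0 := by simp [measureReal_def, hb]
    rw [h0, integral_zero_measure, zero_sub, abs_neg]
    calc |∫ y, W y ∂Measure.map f (μ.restrict S)| ≤ μ.real S := hRS
      _ ≤ t + 2 * w := by linarith
  haveI : IsProbabilityMeasure (ProbabilityTheory.cond μ S) := ProbabilityTheory.cond_isProbabilityMeasure ha
  haveI : IsProbabilityMeasure (ProbabilityTheory.cond ν T) := ProbabilityTheory.cond_isProbabilityMeasure hb
  haveI : IsProbabilityMeasure (Measure.map f (ProbabilityTheory.cond μ S)) :=
    Measure.isProbabilityMeasure_map hf.aemeasurable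
  haveI : IsProbabilityMeasure (Measure.map g (ProbabilityTheory.cond ν T)) :=
    Measure.isProbabilityMeasure_map hg.aemeasurable
  have hAB := h ha hb W hWm hW1
  have hA1 : |∫ y, W y ∂Measure.map f (ProbabilityTheory.cond μ S)| ≤ 1 :=
    (abs_integral_le_real_univ hW1 _).trans measureReal_le_one
  have hrS : Measure.map f (μ.restrict S) = (μ S) • Measure.map f (ProbabilityTheory.cond μ S) := by
    rw [ProbabilityTheory.cond, Measure.map_smul, smul_smul, ENNReal.mul_inv_cancel ha (measure_ne_top μ S), one_smul]
  have hrT : Measure.map g (ν.restrict T) = (ν T) • Measure.map g (ProbabilityTheory.cond ν T) := by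
    rw [ProbabilityTheory.cond, Measure.map_smul, smul_smul, ENNReal.mul_inv_cancel hb (measure_ne_top ν T), one_smul]
  rw [hrS, hrT, integral_smul_measure, integral_smul_measure, smul_eq_mul, smul_eq_mul,
    show (ν T).toReal = ν.real T from rfl, show (μ S).toReal = μ.real S from rfl]
  set A := ∫ y, W y ∂Measure.map f (ProbabilityTheory.cond μ S)
  set B := ∫ y, W y ∂Measure.map g (ProbabilityTheory.cond ν T)
  have hb0 : 0 ≤ ν.real T := measureReal_nonneg
  have hab : |ν.real T - μ.real S| ≤ w := by
    have h1 : 0 ≤ μ.real Sᶜ := measureReal_nonneg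
    have h2 : 0 ≤ ν.real Tᶜ := measureReal_nonneg
    rw [haS, hbT]
    exact abs_le.mpr ⟨by linarith, by linarith⟩
  have e : ν.real T * B - μ.real S * A = ν.real T * (B - A) + (ν.real T - μ.real S) * A := by ring
  rw [e]
  calc |ν.real T * (B - A) + (ν.real T - μ.real S) * A|
      ≤ |ν.real T * (B - A)| + |(ν.real T - μ.real S) * A| := abs_add_le _ _
    _ = ν.real T * |B - A| + |ν.real T - μ.real S| * |A| := by rw [abs_mul, abs_mul, abs_of_nonneg hb0]
    _ ≤ 1 * t + w * 1 :=
        add_le_add (mul_le_mul hb1 hAB (abs_nonneg _) zero_le_one) (mul_le_mul hab hA1 (abs_nonneg _) hw0)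
    _ ≤ t + 2 * w := by linarith

/-- **KL SOCKET ∧ K2 BODY ⇒ TV SOCKET** (`γ ≥ 0`): `t_K = √(2h_K) + 2w_K`, summable. PROVED from M1 (Pinsker) and the bookkeeping
lemma; this is where the data of the route (Gibbs measures, history events, descent maps) meets the abstract entropy mechanism. [cite: PolyanskiyWu2024, Thm 7.10] -/
theorem fluctuationComparisonTVAt_of_klAt (F : T3Family) {γ : ℝ} (hγ : 0 ≤ γ) {b₀ p₀ : ℝ} {m : ℕ}
    (hKL : FluctuationComparisonKLAt F γ b₀ p₀ m) (hT : HistoryTailAt F γ b₀ p₀ m) :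
    FluctuationComparisonTVAt F γ b₀ p₀ m := by
  obtain ⟨h, h0, hs, hKL⟩ := hKL
  obtain ⟨w, hws, hw⟩ := hT
  refine ⟨fun K => Real.sqrt (2 * h K) + 2 * w K, ?_, fun K => ?_⟩
  · have e : (fun K => Real.sqrt (2 * h K)) = fun K => Real.sqrt 2 * Real.sqrt (h K) :=
      funext fun K => Real.sqrt_mul (by norm_num) (h K)
    have hs2 : Summable fun K => Real.sqrt (2 * h K) := by rw [e]; exact hs.mul_left _
    exact hs2.add (hws.mul_left 2)
  · haveI := isProbabilityMeasure_gibbsK F ℰp hγ K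
    haveI := isProbabilityMeasure_gibbsK F ℰp hγ (K + 1)
    refine tvClose_map_restrict_of_cond (measurableSet_histGood F ℰp measurableE_ℰp _ K _)
      (measurableSet_histGood F ℰp measurableE_ℰp _ (K + 1) _) (measurable_descendTo F ℰp measurableE_ℰp _)
      (measurable_descendTo F ℰp measurableE_ℰp _) (Real.sqrt_nonneg _) (fun ha hb => ?_) (hw K).1 (hw K).2
    haveI : IsProbabilityMeasure (ProbabilityTheory.cond (gibbsK F ℰp γ K) (histGood F ℰp (θBal F.L γ b₀ p₀) K (K / m))) :=
      ProbabilityTheory.cond_isProbabilityMeasure ha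
    haveI : IsProbabilityMeasure
        (ProbabilityTheory.cond (gibbsK F ℰp γ (K + 1)) (histGood F ℰp (θBal F.L γ b₀ p₀) (K + 1) (K / m))) :=
      ProbabilityTheory.cond_isProbabilityMeasure hb
    haveI : IsProbabilityMeasure (cmpLaw₀ F γ b₀ p₀ m K) :=
      Measure.isProbabilityMeasure_map (measurable_descendTo F ℰp measurableE_ℰp _).aemeasurable
    haveI : IsProbabilityMeasure (cmpLaw₁ F γ b₀ p₀ m K) :=
      Measure.isProbabilityMeasure_map (measurable_descendTo F ℰp measurableE_ℰp _).aemeasurable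
    exact tvClose_of_klDiv_le (cmpLaw₀ F γ b₀ p₀ m K) (cmpLaw₁ F γ b₀ p₀ m K) (h0 K) (hKL K)

/-- K1 IN KL CURRENCY, route quantifier shape. [cite: PolyanskiyWu2024, Thm 7.10] -/
def FluctuationComparisonKL : Prop :=
  ∀ (L : ℕ), ∃ m : ℕ, 0 < m ∧ ∀ (b₀ p₀ : ℝ), 0 < b₀ → 2 < p₀ → ∃ γ₁ : ℝ, 0 < γ₁ ∧
    ∀ (F : T3Family) (γ : ℝ), F.L = L → 0 < γ → γ ≤ γ₁ → FluctuationComparisonKLAt F γ b₀ p₀ m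

/-- THE VARIANCE STUB, route quantifier shape (`m ≥ 2` is where the TV exponent race is won). [cite: King1986, (3.12) p.657] -/
def DiscrepancyVariance : Prop :=
  ∀ (L : ℕ), ∃ m : ℕ, 2 ≤ m ∧ ∀ (b₀ p₀ : ℝ), 0 < b₀ → 2 < p₀ → ∃ γ₁ : ℝ, 0 < γ₁ ∧
    ∀ (F : T3Family) (γ : ℝ), F.L = L → 0 < γ → γ ≤ γ₁ → DiscrepancyVarianceAt F γ b₀ p₀ m

/-- **THE DECIDING THEOREM IN KL CURRENCY**: `FluctuationComparisonKL → HistoryTail → YM3TorusSU2`.  Kernel-checked modulo M1 (general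
Pinsker) ONLY — K2 is used twice: for the tails in the Cauchy device and for the normalisation of the conditional laws. [cite: King1986, (3.12)-(3.13) p.657] -/
theorem closes_KL (hK1 : FluctuationComparisonKL) (hK2 : Summit.QuantumFields.YangMills.Theses.UnitScaleTilt.HistoryTail) :
    T3YM3TorusStatement.YM3TorusSU2 := by
  refine ⟨1, one_pos, fun F γ hγ _ => ?_⟩
  obtain ⟨m, hm, hS⟩ := hK1 F.L
  obtain ⟨b₀, p₀, γ₂, hb₀, hp₀, hγ₂, hT⟩ := hK2 F.L m hm
  obtain ⟨γ₃, hγ₃, hS⟩ := hS b₀ p₀ hb₀ hp₀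
  obtain ⟨n, hpos, hle⟩ := exists_refine_depth' F.hL.2 hγ (lt_min hγ₂ hγ₃)
  have hT' := hT (F.refine n) _ rfl hpos (hle.trans (min_le_left _ _))
  exact continuumYM3Torus_of_unitTVAt_historyTailAt F hγ.le n hpos.le
    (unitTVAt_of_fluctuationComparisonTVAt _ _ _ _ _
      (fluctuationComparisonTVAt_of_klAt (F.refine n) hpos.le (hS (F.refine n) _ rfl hpos (hle.trans (min_le_right _ _))) hT'))
    hT'

/-- **… AND IN VARIANCE CURRENCY**: `DiscrepancyVariance → HistoryTail → YM3TorusSU2` (modulo M1 and M2′). [cite: King1986, (3.12)-(3.13) p.657] -/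
theorem closes_Var (hV : DiscrepancyVariance) (hK2 : Summit.QuantumFields.YangMills.Theses.UnitScaleTilt.HistoryTail) :
    T3YM3TorusStatement.YM3TorusSU2 := by
  refine closes_KL (fun L => ?_) hK2
  obtain ⟨m, hm, hS⟩ := hV L
  refine ⟨m, by omega, fun b₀ p₀ hb₀ hp₀ => ?_⟩
  obtain ⟨γ₁, hγ₁, hS⟩ := hS b₀ p₀ hb₀ hp₀
  exact ⟨γ₁, hγ₁, fun F γ hF hγ hle => klAt_of_varianceAt F hm (hS F γ hF hγ hle)⟩



/-! ### §D″ (g3, session 5) — THE SAME SOCKETS IN THE ROUTE'S ERRATUM-v3′ QUANTIFIER SHAPE (owner g17, rev 9: cone = {19200,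
`FluctuationComparisonRegPrL` = stmt-19935, `HistoryTailL` = stmt-19936}; `FluctuationComparisonRegPr` = stmt-19201 is now an ASIDE).
K1′ in TV / KL / variance currency with print's «(b₀, p₀) sufficiently large» thresholds ([Balaban1985UV3] (7) p.257), decided against
`HistoryTailL` in the owner's order of choices (thresholds from the comparison side at `L`; profile from the history side BEFORE `m`;
`m` and `γ₁` from the comparison side at the profile; refine below both).  No `ε₀`, no `m₀`-floor coupling with stmt-19200: in TV
currency there is no background subtraction, so `MinimiserStabilityRegPr` is not a hypothesis of the deciding theorem (it re-enters only
INSIDE a proof of the variance stub, as analysis of the two runs' laws). -/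

/-- K1′-L in TV currency at the comparison height (thresholded profiles). [cite: Balaban1985UV3, (7) p.257 and (41) p.266] -/
def FluctuationComparisonTVL : Prop :=
  ∀ (L : ℕ), ∃ (b₁ p₁ : ℝ), ∀ (b₀ p₀ : ℝ), b₁ ≤ b₀ → p₁ ≤ p₀ → 0 < b₀ → 2 < p₀ → ∃ m : ℕ, 0 < m ∧ ∃ γ₁ : ℝ, 0 < γ₁ ∧
    ∀ (F : T3Family) (γ : ℝ), F.L = L → 0 < γ → γ ≤ γ₁ → FluctuationComparisonTVAt F γ b₀ p₀ m

/-- K1′-L in KL currency (square-root-summable relative entropies of the conditioned, descended laws). [cite: PolyanskiyWu2024, Thm 7.10] -/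
def FluctuationComparisonKLL : Prop :=
  ∀ (L : ℕ), ∃ (b₁ p₁ : ℝ), ∀ (b₀ p₀ : ℝ), b₁ ≤ b₀ → p₁ ≤ p₀ → 0 < b₀ → 2 < p₀ → ∃ m : ℕ, 0 < m ∧ ∃ γ₁ : ℝ, 0 < γ₁ ∧
    ∀ (F : T3Family) (γ : ℝ), F.L = L → 0 < γ → γ ≤ γ₁ → FluctuationComparisonKLAt F γ b₀ p₀ m

/-- THE VARIANCE STUB, thresholded shape (`2 ≤ m` is where the TV exponent race is won). [cite: King1986, (3.12) p.657] -/
def DiscrepancyVarianceL : Prop :=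
  ∀ (L : ℕ), ∃ (b₁ p₁ : ℝ), ∀ (b₀ p₀ : ℝ), b₁ ≤ b₀ → p₁ ≤ p₀ → 0 < b₀ → 2 < p₀ → ∃ m : ℕ, 2 ≤ m ∧ ∃ γ₁ : ℝ, 0 < γ₁ ∧
    ∀ (F : T3Family) (γ : ℝ), F.L = L → 0 < γ → γ ≤ γ₁ → DiscrepancyVarianceAt F γ b₀ p₀ m

/-- **THE DECIDING THEOREM IN TV CURRENCY, ERRATUM-v3′ SHAPE**: `FluctuationComparisonTVL → HistoryTailL → YM3TorusSU2` — two
hypotheses where the route's `closes` (rev 9) has three. PROVED, no sorry in the cone. [cite: King1986, (3.12)-(3.13) p.657] -/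
theorem closes_TVL (hK1 : FluctuationComparisonTVL) (hK2 : Summit.QuantumFields.YangMills.Theses.UnitScaleTilt.HistoryTailL) :
    T3YM3TorusStatement.YM3TorusSU2 := by
  refine ⟨1, one_pos, fun F γ hγ _ => ?_⟩
  obtain ⟨b₁, p₁, hB⟩ := hK1 F.L
  obtain ⟨b₀, p₀, hb₁, hp₁, hb₀, hp₀, hT⟩ := hK2 F.L b₁ p₁
  obtain ⟨m, hm, γ₃, hγ₃, hS⟩ := hB b₀ p₀ hb₁ hp₁ hb₀ hp₀
  obtain ⟨γ₂, hγ₂, hT'⟩ := hT m hm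
  obtain ⟨n, hpos, hle⟩ := exists_refine_depth' F.hL.2 hγ (lt_min hγ₂ hγ₃)
  exact continuumYM3Torus_of_unitTVAt_historyTailAt F hγ.le n hpos.le
    (unitTVAt_of_fluctuationComparisonTVAt _ _ _ _ _ (hS (F.refine n) _ rfl hpos (hle.trans (min_le_right _ _))))
    (hT' (F.refine n) _ rfl hpos (hle.trans (min_le_left _ _)))

/-- **… IN KL CURRENCY, ERRATUM-v3′ SHAPE** (modulo M1 = general Pinsker only; `HistoryTailL` used twice: tails and normalisation). [cite: PolyanskiyWu2024, Thm 7.10] -/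
theorem closes_KLL (hK1 : FluctuationComparisonKLL) (hK2 : Summit.QuantumFields.YangMills.Theses.UnitScaleTilt.HistoryTailL) :
    T3YM3TorusStatement.YM3TorusSU2 := by
  refine ⟨1, one_pos, fun F γ hγ _ => ?_⟩
  obtain ⟨b₁, p₁, hB⟩ := hK1 F.L
  obtain ⟨b₀, p₀, hb₁, hp₁, hb₀, hp₀, hT⟩ := hK2 F.L b₁ p₁
  obtain ⟨m, hm, γ₃, hγ₃, hS⟩ := hB b₀ p₀ hb₁ hp₁ hb₀ hp₀
  obtain ⟨γ₂, hγ₂, hT'⟩ := hT m hm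
  obtain ⟨n, hpos, hle⟩ := exists_refine_depth' F.hL.2 hγ (lt_min hγ₂ hγ₃)
  have hT'' := hT' (F.refine n) _ rfl hpos (hle.trans (min_le_left _ _))
  exact continuumYM3Torus_of_unitTVAt_historyTailAt F hγ.le n hpos.le
    (unitTVAt_of_fluctuationComparisonTVAt _ _ _ _ _
      (fluctuationComparisonTVAt_of_klAt (F.refine n) hpos.le (hS (F.refine n) _ rfl hpos (hle.trans (min_le_right _ _))) hT''))
    hT''

/-- **… AND IN VARIANCE CURRENCY, ERRATUM-v3′ SHAPE** (modulo M1 and M2′). [cite: King1986, (3.12)-(3.13) p.657] -/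
theorem closes_VarL (hV : DiscrepancyVarianceL) (hK2 : Summit.QuantumFields.YangMills.Theses.UnitScaleTilt.HistoryTailL) :
    T3YM3TorusStatement.YM3TorusSU2 := by
  refine closes_KLL (fun L => ?_) hK2
  obtain ⟨b₁, p₁, hB⟩ := hV L
  refine ⟨b₁, p₁, fun b₀ p₀ hb₁ hp₁ hb₀ hp₀ => ?_⟩
  obtain ⟨m, hm, γ₁, hγ₁, hS⟩ := hB b₀ p₀ hb₁ hp₁ hb₀ hp₀
  exact ⟨m, by omega, γ₁, hγ₁, fun F γ hF hγ hle => klAt_of_varianceAt F hm (hS F γ hF hγ hle)⟩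

/-- The unthresholded TV socket implies the thresholded one (`b₁ = p₁ = 0`): card 4's original `W` is the STRONGER ask. PROVED. [folklore] -/
theorem fluctuationComparisonTVL_of_TV (h : FluctuationComparisonTV) : FluctuationComparisonTVL := by
  intro L
  obtain ⟨m, hm, hS⟩ := h L
  refine ⟨0, 0, fun b₀ p₀ _ _ hb₀ hp₀ => ?_⟩
  obtain ⟨γ₁, hγ₁, hS⟩ := hS b₀ p₀ hb₀ hp₀
  exact ⟨m, hm, γ₁, hγ₁, hS⟩

end CardFour

end Summit.QuantumFields.YangMills.Cruxes.FluctuationComparisonRegPr.IdeasTransfer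

end
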